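import Mathlib

/-!
# Imbrie (2016): single-site graphs of every order are non-zero — the 2×2 fibre computation
(AUDIT-CELL LEMMA supporting SURVIVAL.md §4E′ (iv⁗)(2), finding F1)

CITATION HEADER (audit cell pub-imbrie, build tag b2b; seat b2b-imbrie-2-g5).
Source audited: J. Z. Imbrie, "On Many-Body Localization for Quantum Spin Chains", J. Stat. Phys. 163
(2016) 998–1048 = arXiv:1403.7837v3 (bib key ImbrieJSP2016).  Passages (arXiv v3 TeX chunk locators):
* (2.6) [p0006 l.52]: "A(i)_{σσ^{(i)}} = J^{(0)per}(i)_{σσ^{(i)}}/(E(σ) − E(σ^{(i)})) = γ_i/(E(σ) − E(σ^{(i)}))";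
  [p0006 l.55] "A(i) only connects spin configurations differing by a single flip at i"; [p0006 l.67]
  "even though A(i) and J(i) only act on the i-th spin component, the matrix elements of A(i) depend on
  the spins at i − 1 and i + 1".
* [p0007 l.1]: "g_1 prescribes an ordered product of operators A(i_p) or J^{(0)}(i_0) arising from an
  admissible sequence i_0, i_1, …, i_n after expanding the commutators (admissible means each i_p is with a
  distance 1 of {i_0, i_1, …, i_{p−1}}, for a nonvanishing commutator)".
* §4.3.1 [p0028 l.8–14]: long graphs "for given initial and final spin configurations σ, σ̃ and a given
  interval I = I(g)" are resummed into the jump transition {σ, σ̃, I}; (4.4): a jump step on I has booked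
  length |I| ∨ (7/8)L.

WHAT THIS FILE IS.  On the fibre where the neighbouring spins σ_{x−1}, σ_{x+1} are frozen, the operators
J^{(0)}(x) and A(x) of (2.6) act on the single spin at x as the 2×2 matrices `J = b·N`, `A = c·M` with
`N = !![0,1;1,0]` (the flip) and `M = !![0,1;-1,0]` (the flip divided by the antisymmetric energy
denominator), `b = γ_x`, `c = γ_x/(E(σ) − E(σ^{(x)}))`.  We compute the iterated commutators in closed
form: `(ad A)J = cb·diag(2,−2)`, `(ad A)²J = −4c²·J`, hence `(ad A)^{2m}J = (−4c²)^m J` and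
`(ad A)^{2m+1}J = (−4c²)^m cb·diag(2,−2)`, all non-zero when `b, c ≠ 0` (over any linearly ordered field).
So the admissible sequence x, x, …, x (every step at distance 0) labels a NON-VANISHING term at every order:
single-site graphs of every length exist, alternately off-diagonal (odd number of flips: a transition
σ → σ^{(x)} with I = {x}) and diagonal.  Those with an odd number of flips (even commutator order) and
length ≥ L_{k−1} are long (|I| = 1 ≤ k − 1) and are resummed into jump steps {σ, σ^{(x)}, {x}} of booked
length (7/8)L_{k−1} — the "floating jump-step children" of the family F1 in SURVIVAL.md §4E′ (iv⁗)(2)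
(FloatingRatio.lean).  This file certifies only the 2×2 algebra (at step 1; at later steps the single-site
operators are again spanned by the flip N, its antisymmetrisation M and diag(1,−1), with other non-zero
scalars); that these terms survive in J^{(k)} with the stated bookkeeping is a located reading of the text.
Cell verdict unchanged (LLA open; LLA-free part conditional on §4.2.1).
-/

namespace Literature.MathematicalPhysics.QuantumLattice.Imbrie2016

open Matrix

/-- One commutator: `[A, J] = A J − J A = (c b)·diag(2, −2)` for `A = !![0,c;-c,0]`, `J = !![0,b;b,0]`
— a non-zero DIAGONAL operator (the second-order energy shift). [cite: ImbrieJSP2016, (2.6) and (2.7) "(ad A)^n"] -/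
theorem singleSite_ad_once {R : Type*} [CommRing R] (c b : R) :
    !![0, c; -c, 0] * !![0, b; b, 0] - !![0, b; b, 0] * !![0, c; -c, 0]
      = (c * b) • (!![2, 0; 0, -2] : Matrix (Fin 2) (Fin 2) R) := by
  ext i j
  fin_cases i <;> fin_cases j <;> simp <;> ring

/-- Two commutators: `(ad A)² (r·J) = r(−4c²)·J` — back to a non-zero multiple of the flip (stated with a
scalar `r` so that it drives the induction below). [cite: ImbrieJSP2016, (2.6)–(2.8)] -/
theorem singleSite_ad_twice {R : Type*} [CommRing R] (c b r : R) :
    !![0, c; -c, 0] * (!![0, c; -c, 0] * (r • !![0, b; b, 0]) - (r • !![0, b; b, 0]) * !![0, c; -c, 0])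
      - (!![0, c; -c, 0] * (r • !![0, b; b, 0]) - (r • !![0, b; b, 0]) * !![0, c; -c, 0]) * !![0, c; -c, 0]
      = (r * (-4 * c ^ 2)) • (!![0, b; b, 0] : Matrix (Fin 2) (Fin 2) R) := by
  ext i j
  fin_cases i <;> fin_cases j <;> simp <;> ring

/-- Closed form, even order: `(ad A)^{2m} J = (−4c²)^m · J`. [cite: ImbrieJSP2016, (2.7)–(2.8) "admissible sequence … for a nonvanishing commutator"] -/
theorem singleSite_ad_iterate_even {R : Type*} [CommRing R] (c b : R) (m : ℕ) :
    (fun X : Matrix (Fin 2) (Fin 2) R => !![0, c; -c, 0] * X - X * !![0, c; -c, 0])^[2 * m]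
        (!![0, b; b, 0] : Matrix (Fin 2) (Fin 2) R)
      = ((-4 * c ^ 2) ^ m) • (!![0, b; b, 0] : Matrix (Fin 2) (Fin 2) R) := by
  induction m with
  | zero => simp
  | succ m ih =>
      rw [show 2 * (m + 1) = 2 + 2 * m by ring, Function.iterate_add_apply, ih]
      simp only [Function.iterate_succ_apply', Function.iterate_zero_apply]
      rw [singleSite_ad_twice c b ((-4 * c ^ 2) ^ m)]
      congr 1
      ring

/-- Closed form, odd order: `(ad A)^{2m+1} J = (−4c²)^m (c b) · diag(2, −2)`. [cite: ImbrieJSP2016, (2.7)–(2.8)] -/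
theorem singleSite_ad_iterate_odd {R : Type*} [CommRing R] (c b : R) (m : ℕ) :
    (fun X : Matrix (Fin 2) (Fin 2) R => !![0, c; -c, 0] * X - X * !![0, c; -c, 0])^[2 * m + 1]
        (!![0, b; b, 0] : Matrix (Fin 2) (Fin 2) R)
      = ((-4 * c ^ 2) ^ m * (c * b)) • (!![2, 0; 0, -2] : Matrix (Fin 2) (Fin 2) R) := by
  rw [Function.iterate_succ_apply', singleSite_ad_iterate_even]
  ext i j
  fin_cases i <;> fin_cases j <;> simp <;> ring

/-- Non-vanishing at EVERY order over a linear ordered field (e.g. ℝ) when `b ≠ 0` (coupling `γ_x ≠ 0`) and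
`c ≠ 0` (finite energy denominator): the single-site walk `x, x, …, x` labels a non-zero term of
`(ad A)^n J` for all `n`.  (Audit-cell lemma; used for the admissibility of single-site jump steps in F1.)
[cite: ImbrieJSP2016, (2.8) "admissible means each i_p is with a distance 1 of {i_0, …, i_{p−1}}, for a nonvanishing commutator"] -/
theorem singleSite_ad_iterate_ne_zero {K : Type*} [Field K] [LinearOrder K] [IsStrictOrderedRing K] {c b : K} (hc : c ≠ 0)
    (hb : b ≠ 0) (n : ℕ) :
    (fun X : Matrix (Fin 2) (Fin 2) K => !![0, c; -c, 0] * X - X * !![0, c; -c, 0])^[n]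
        (!![0, b; b, 0] : Matrix (Fin 2) (Fin 2) K) ≠ 0 := by
  have h4 : (-4 * c ^ 2 : K) ≠ 0 := mul_ne_zero (by norm_num) (pow_ne_zero 2 hc)
  have hJ : (!![0, b; b, 0] : Matrix (Fin 2) (Fin 2) K) ≠ 0 := fun h =>
    hb (by simpa using congrArg (fun M : Matrix (Fin 2) (Fin 2) K => M 0 1) h)
  have hD : (!![2, 0; 0, -2] : Matrix (Fin 2) (Fin 2) K) ≠ 0 := fun h => by
    simpa using congrArg (fun M : Matrix (Fin 2) (Fin 2) K => M 0 0) h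
  obtain ⟨m, hm | hm⟩ := Nat.even_or_odd' n
  · rw [hm, singleSite_ad_iterate_even]
    exact fun h => hJ ((IsUnit.smul_eq_zero (isUnit_iff_ne_zero.mpr (pow_ne_zero _ h4))).mp h)
  · rw [hm, singleSite_ad_iterate_odd]
    exact fun h => hD ((IsUnit.smul_eq_zero (isUnit_iff_ne_zero.mpr
      (mul_ne_zero (pow_ne_zero _ h4) (mul_ne_zero hc hb)))).mp h)

end Literature.MathematicalPhysics.QuantumLattice.Imbrie2016
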